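import Mathlib.RingTheory.MvPolynomial.Basic
import Mathlib.RingTheory.Ideal.Operations
import Mathlib.Algebra.BigOperators.Fin
import HarnessLib

/-!
# Multi-vertex monomial cover records (the `hcov` binder, several chart vertices) [OURS · L1 W4.5a]

(crux `FInjectiveMacaulayfication` stmt-ResolutionOfSingularities-15315, chain w45a; res-L1-w45a-plan-1 RULING R18.29 «P2d4B row 3:
extend the cover witnesses to multi-vertex integral-dependence relations»; seat res-L1-w45a-lead-1 g8.)

The road-B frame's cover binder (`RoadBFrame`, consumed by `CICertificates.ciCertificates`) asks, for each generator
exponent `a ∈ A`, a chart `c`, a multiplier `K ≥ 1` and a witness `y ∈ (Ideal.span (monomial '' A)) ^ (K - 1)` with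
`(monomial a 1) ^ K = monomial (m c) 1 * y`. `MonomialCoverRecord.hcov_of_record` produces it from a TWO-TERM record
`K • a = m c + (K - 1) • b + r`, `b ∈ A`. Some fans (res-L1-w45a-idea-1's P2d4B product certificate: 37 of 250 generators)
only admit MULTI-VERTEX records
`(∑ c, cnt c) • a = ∑ c, cnt c • m c + r`, `cnt c₀ ≥ 1` for some chart `c₀`.
Since every chart vertex is a generator (`m c ∈ A`, the α-tables' `hm`), the witness
`y := (monomial (m c₀) 1) ^ (cnt c₀ - 1) * ∏_{c ≠ c₀} (monomial (m c) 1) ^ (cnt c) * monomial r 1`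
has `A`-degree `∑ cnt - 1 = K - 1`, so the SAME binder is met — no change to the frame.

* `prod_pow_mem_pow_sum` — `∏ c ∈ s, x c ^ e c ∈ I ^ (∑ c ∈ s, e c)` when every `x c ∈ I`; `prod_monomial_one_pow` — `∏ (monomial (m c) 1) ^ e c = monomial (∑ e c • m c) 1`;
* `monomialCoverMultiRecord` — the witness for one multi-vertex record;
* `hcov_of_multiRecord` — the same in the literal `∃ c K, 1 ≤ K ∧ ∃ y ∈ _, _` shape of the `hcov` binder
  (`K := ∑ c, cnt c`, chart `:= c₀`), so a generated data module closes each `a ∈ A` by one `exact`.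

Def-free plumbing; replaces the role of NO printed item. AI-written (AI review is weaker than expert review). [folklore]
-/

set_option linter.dupNamespace false -- mandated namespace of this single-conjunct summit

namespace Summit.ResolutionOfSingularities.ResolutionOfSingularities.Theorems.FInjectiveMacaulayfication.MonomialCoverMultiRecord

open MvPolynomial

/-- [OURS · L1 W4.5a] A product of powers of elements of an ideal lies in the power of the ideal indexed by the total
exponent: `∏ c ∈ s, x c ^ e c ∈ I ^ (∑ c ∈ s, e c)` when `x c ∈ I` for all `c ∈ s`. [folklore] -/
theorem prod_pow_mem_pow_sum {R : Type*} [CommSemiring R] {ι : Type*} (s : Finset ι) (I : Ideal R)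
    (x : ι → R) (e : ι → ℕ) (hx : ∀ c ∈ s, x c ∈ I) :
    ∏ c ∈ s, x c ^ e c ∈ I ^ (∑ c ∈ s, e c) := by
  classical
  induction s using Finset.induction_on with
  | empty => simp
  | @insert c s hc ih =>
    rw [Finset.prod_insert hc, Finset.sum_insert hc, pow_add]
    exact Ideal.mul_mem_mul (Ideal.pow_mem_pow (hx c (Finset.mem_insert_self c s)) _)
      (ih fun c' hc' => hx c' (Finset.mem_insert_of_mem hc'))

/-- [OURS · L1 W4.5a] Products of powers of monic monomials: `∏ c ∈ s, (monomial (m c) 1) ^ e c = monomial (∑ c ∈ s, e c • m c) 1`. [folklore] -/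
theorem prod_monomial_one_pow {k : Type*} [CommSemiring k] {n : ℕ} {ι : Type*} (s : Finset ι) (m : ι → (Fin n →₀ ℕ)) (e : ι → ℕ) :
    ∏ c ∈ s, (monomial (m c) (1 : k) : MvPolynomial (Fin n) k) ^ e c = monomial (∑ c ∈ s, e c • m c) 1 := by
  classical
  induction s using Finset.induction_on with
  | empty => simp
  | @insert c s hc ih =>
    rw [Finset.prod_insert hc, Finset.sum_insert hc, ih, monomial_pow, one_pow, monomial_mul, mul_one]

/-- [OURS · L1 W4.5a] The `hcov` witness from one MULTI-VERTEX cover record: if every chart vertex is a generator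
(`m c ∈ A`), `cnt c₀ ≥ 1`, and `(∑ c, cnt c) • a = ∑ c, cnt c • m c + r`, then
`(monomial a 1) ^ (∑ c, cnt c) = monomial (m c₀) 1 * y` for some `y` in the `(∑ c, cnt c) - 1`-st power of the monomial
ideal spanned by `A`. [folklore] -/
theorem monomialCoverMultiRecord (k : Type*) [CommSemiring k] {n t : ℕ} (A : Finset (Fin n →₀ ℕ))
    (m : Fin t → (Fin n →₀ ℕ)) (hm : ∀ c, m c ∈ A) (a : Fin n →₀ ℕ) (c₀ : Fin t) (cnt : Fin t → ℕ)
    (hc₀ : 1 ≤ cnt c₀) (r : Fin n →₀ ℕ) (hrec : (∑ c, cnt c) • a = ∑ c, cnt c • m c + r) :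
    ∃ y ∈ (Ideal.span ((fun b : Fin n →₀ ℕ => (monomial b (1 : k) : MvPolynomial (Fin n) k)) ''
        (A : Set (Fin n →₀ ℕ)))) ^ ((∑ c, cnt c) - 1),
      (monomial a (1 : k) : MvPolynomial (Fin n) k) ^ (∑ c, cnt c) = monomial (m c₀) 1 * y := by
  classical
  set I : Ideal (MvPolynomial (Fin n) k) :=
    Ideal.span ((fun b : Fin n →₀ ℕ => (monomial b (1 : k) : MvPolynomial (Fin n) k)) '' (A : Set (Fin n →₀ ℕ))) with hI
  -- reduced multiplicities: one copy of the vertex `m c₀` is taken out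
  set cnt' : Fin t → ℕ := Function.update cnt c₀ (cnt c₀ - 1) with hcnt'
  have hsum : ∑ c, cnt c = (∑ c, cnt' c) + 1 := by
    have h1 : ∑ c, cnt c = cnt c₀ + ∑ c ∈ Finset.univ.erase c₀, cnt c :=
      (Finset.add_sum_erase Finset.univ cnt (Finset.mem_univ c₀)).symm
    have h2 : ∑ c, cnt' c = cnt' c₀ + ∑ c ∈ Finset.univ.erase c₀, cnt' c :=
      (Finset.add_sum_erase Finset.univ cnt' (Finset.mem_univ c₀)).symm
    have h3 : ∑ c ∈ Finset.univ.erase c₀, cnt' c = ∑ c ∈ Finset.univ.erase c₀, cnt c :=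
      Finset.sum_congr rfl fun c hc => by rw [hcnt', Function.update_of_ne (Finset.ne_of_mem_erase hc)]
    have h4 : cnt' c₀ = cnt c₀ - 1 := by rw [hcnt', Function.update_self]
    rw [h1, h2, h3, h4]
    omega
  have hvec : ∑ c, cnt c • m c = m c₀ + ∑ c, cnt' c • m c := by
    have h1 : ∑ c, cnt c • m c = cnt c₀ • m c₀ + ∑ c ∈ Finset.univ.erase c₀, cnt c • m c :=
      (Finset.add_sum_erase Finset.univ (fun c => cnt c • m c) (Finset.mem_univ c₀)).symm
    have h2 : ∑ c, cnt' c • m c = cnt' c₀ • m c₀ + ∑ c ∈ Finset.univ.erase c₀, cnt' c • m c :=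
      (Finset.add_sum_erase Finset.univ (fun c => cnt' c • m c) (Finset.mem_univ c₀)).symm
    have h3 : ∑ c ∈ Finset.univ.erase c₀, cnt' c • m c = ∑ c ∈ Finset.univ.erase c₀, cnt c • m c :=
      Finset.sum_congr rfl fun c hc => by rw [hcnt', Function.update_of_ne (Finset.ne_of_mem_erase hc)]
    have h4 : cnt' c₀ = cnt c₀ - 1 := by rw [hcnt', Function.update_self]
    have h5 : cnt c₀ • m c₀ = m c₀ + (cnt c₀ - 1) • m c₀ := by
      conv_lhs => rw [show cnt c₀ = 1 + (cnt c₀ - 1) by omega]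
      rw [add_smul, one_smul]
    rw [h1, h2, h3, h4, h5, add_assoc]
  refine ⟨(∏ c, (monomial (m c) (1 : k)) ^ cnt' c) * monomial r 1, ?_, ?_⟩
  · rw [hsum, Nat.add_sub_cancel]
    exact Ideal.mul_mem_right _ _
      (prod_pow_mem_pow_sum Finset.univ I (fun c => (monomial (m c) (1 : k) : MvPolynomial (Fin n) k)) cnt'
        fun c _ => Ideal.subset_span ⟨m c, by exact_mod_cast hm c, rfl⟩)
  · rw [prod_monomial_one_pow, monomial_pow, one_pow, hrec, hvec, monomial_mul, monomial_mul, mul_one, mul_one, add_assoc]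

/-- [OURS · L1 W4.5a] One MULTI-VERTEX record in the literal shape of the `hcov` binder of `CICertificates.ciCertificates` /
`RoadBFrame`: chart `c₀`, multiplier `K := ∑ c, cnt c ≥ 1`, witness in `I_A ^ (K - 1)`. -/
theorem hcov_of_multiRecord (k : Type*) [CommSemiring k] {n t : ℕ} (A : Finset (Fin n →₀ ℕ))
    (m : Fin t → (Fin n →₀ ℕ)) (hm : ∀ c, m c ∈ A) (a : Fin n →₀ ℕ) (c₀ : Fin t) (cnt : Fin t → ℕ)
    (hc₀ : 1 ≤ cnt c₀) (r : Fin n →₀ ℕ) (hrec : (∑ c, cnt c) • a = ∑ c, cnt c • m c + r) :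
    ∃ (c : Fin t) (K : ℕ), 1 ≤ K ∧
      ∃ y ∈ (Ideal.span ((fun b : Fin n →₀ ℕ => (monomial b (1 : k) : MvPolynomial (Fin n) k)) ''
          (A : Set (Fin n →₀ ℕ)))) ^ (K - 1),
        (monomial a (1 : k) : MvPolynomial (Fin n) k) ^ K = monomial (m c) 1 * y :=
  ⟨c₀, ∑ c, cnt c, le_trans hc₀ (Finset.single_le_sum (fun c _ => Nat.zero_le (cnt c)) (Finset.mem_univ c₀)),
    monomialCoverMultiRecord k A m hm a c₀ cnt hc₀ r hrec⟩

end Summit.ResolutionOfSingularities.ResolutionOfSingularities.Theorems.FInjectiveMacaulayfication.MonomialCoverMultiRecord
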